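import Summits.QuantumFields.YangMills.Theorems.BalabanUVNodesK0RecordFormatNamesFluctHopC
import Summits.QuantumFields.YangMills.Theorems.BalabanUVNodesPortS1QtCReal
import Summits.QuantumFields.YangMills.Theorems.BalabanUVNodesPortS1HopInverse
import Summits.QuantumFields.YangMills.Theorems.BalabanUVNodesPortS1SmallSu2
import Summits.QuantumFields.YangMills.Theorems.BalabanUVNodesPortS1JacobianHolo
import Summits.QuantumFields.YangMills.Theorems.BalabanUVNodesPortS1JacIntGauge

/-!
# Port S1, socket (o1) leaf (o1-β)₃b — THE (R-k) BRIDGES OVER DEF-1's `…FluctHopC`: `coarseCoordC ∘ recordLQtC` IS THE COMPLEXIFIED REAL MATRIX OF `LQ̃`, ITS `b₀`-BLOCK IS `recordLQtB0C`,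
# `hopLinGraphC` ON 𝔰𝔲(2)-FIELDS IS `↑hopLinGraph`, AND `LQ̃_ℂ ∘ h_ℂ = id` ON TRACE-FREE COARSE FIELDS (under the letter `RecordB0BlockInvertible`)

Cell `ym-nodeO-ideate`, porter seat PT-A-1 (gen 9); `--kind proof --supports stmt-QuantumFields-27930 --as helper`; count-neutral.  ◆ CRIT-1 g39 rider (R-k): the identifications between DEF-1's
complexified carriers (ed.29 ✓`recordLQtC`, ed.30 ✓`coarseCoordC`∕`recordLQtB0C`∕`hopLinGraphC`) and the real record objects (ed.15 ✓`recordLQt`∕`recordLQtMat`∕`recordLQtB0`, ▶ PT-A-1's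
✓`coarseCoord`∕`hopLinGraph`) are BRIDGE THEOREMS in the porter's files, never second objects.  This file is those theorems.  [I] = [Balaban1987RG1].

WHAT IS PROVED (standing hypotheses of (o1-β)₃a ✓`recordLQtC_ofReal`: `k + 1 ≤ m + K`, the background `Vk` (0.4)-guarded with loops within `ε ≤ 1∕50` of `1`):
* §1 `su2CoordCt_of_mem_lieSU`, `coarseCoordC_of_mem_lieSU` (on 𝔰𝔲(2) the trace-projected complex reading is the real one); ★ `su2CoordCt_recordLQtC_single` — the complex coordinates of
  `LQ̃_ℂ` on the coordinate vectors ARE ed.15d's real matrix `recordLQtMat` (bridge (o1-β)₃a + ✓`recordLQt_mem_lieSU_of_small`); ★ `recordLQtB0C_eq` — DEF-1's entrywise-complexified block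
  `recordLQtB0C` IS the `b₀`-block of `coarseCoordC ∘ recordLQtC`; ★ `coarseCoordC_recordLQtC` — `coarseCoordC (LQ̃_ℂ v) = (recordLQtMat.map ↑) *ᵥ v` for EVERY complex `v`; `trace_recordLQtC_apply`.
* §2 `map_algebraMap_nonsing_inv` (folklore: entrywise complexification commutes with the nonsingular inverse, junk included), `hopLinGraphC_apply_b0`, ★ `hopLinGraphC_of_mem_lieSU` — on
  𝔰𝔲(2)-valued coarse fields `hopLinGraphC Vk D = ↑(hopLinGraph Vk D)`.
* §3 ★★ `coarseCoordC_recordLQtC_hopLinGraphC` — print's «LQ̃h = I» over `ℂ`, in coordinates: `coarseCoordC (LQ̃_ℂ (h_ℂ D)) = coarseCoordC D` for EVERY coarse matrix field `D`, under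
  `RecordB0BlockInvertible`; ★★ `recordLQtC_hopLinGraphC_of_trace_eq_zero` — hence `LQ̃_ℂ (h_ℂ D) = D` for every TRACE-FREE (𝔰𝔩(2,ℂ)-valued) `D` (the fields `D̃(B)` of p.267 are such:
  `C̃ = Q̃ − LQ̃` is trace-free-valued).  REMARK (located, for (o1-ε)): lit ✓`B12Lineariz267.linearizes_Dt` asks `LQ (hop X) = X` for ALL `X : 𝒳`; with DEF-1's carrier
  `𝒳 = (PBond (k+1) → MatA 2)` this holds exactly on the trace-free fields (§3), which is where `D̃` lives — the (o1-ε) file states the linearisation accordingly.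

HONEST FRAMING.  Finite-dimensional linear algebra over the (o1-β)₃a bridge; nothing of Bałaban is discharged beyond bookkeeping; `‖h_ℂ‖ ≤ b` ((o1-δ)) and `exists_Dt` ((o1-ε)) NOT here;
`stub_FE` (XXL) ∕ `stub_P0C` OPEN, ⟨27930⟩ OPEN (1∕3); NODE O 0∕1; COUNT 8∕28 · K 1∕4 UNMOVED; finite `𝕋⁴_{L^K}` at fixed ε — NOT continuum ∕ OS; **the Yang–Mills mass gap (Clay) is NOT
proved by any of this.**  No `sorry`; standard axioms only.
-/

noncomputable section

open scoped BigOperators Matrix.Norms.L2Operator Topology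

open Set Metric Filter

namespace Summit.QuantumFields.YangMills.Theorems.BalabanUVNodesPortS1

open Literature.MathematicalPhysics.QuantumFieldTheory.Balaban1983to89
open Literature.MathematicalPhysics.QuantumFieldTheory.Balaban1983to89.Node00
open Literature.MathematicalPhysics.QuantumFieldTheory.Balaban1983to89.T4Continuum (T4Family)
open Literature.MathematicalPhysics.QuantumFieldTheory.Balaban1983to89.T4AdjointCovarianceUnitary (lieSU mem_lieSU_iff)
open Summit.QuantumFields.YangMills.Theorems.K0RecordFormatNames
open BlockAveraging (Small Idx)
open ExpMeanLog (expMeanLogSU)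
open _root_.Matrix

variable (F : T4Family)

/-! ## §1  Complex coordinates of `LQ̃_ℂ` = the real matrix of `LQ̃` -/

/-- On 𝔰𝔲(2) the trace-projected complex coordinates are the real coordinates. [folklore] -/
theorem su2CoordCt_of_mem_lieSU {M : MatA 2} (hM : M ∈ lieSU (Fin 2)) (i : Fin 3) :
    su2CoordCt M i = ((su2Coord M i : ℝ) : ℂ) := by
  rw [su2CoordCt_of_trace_eq_zero (mem_lieSU_iff.1 hM).2]
  exact su2CoordC_of_mem_lieSU hM i

/-- On 𝔰𝔲(2)-valued coarse fields `coarseCoordC = ↑coarseCoord`. [cite: Balaban1987RG1, p.267 (bookkeeping)] -/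
theorem coarseCoordC_of_mem_lieSU (k K : ℕ) (D : PBond (F.P K) (k + 1) → MatA 2) (hD : ∀ c, D c ∈ lieSU (Fin 2)) :
    coarseCoordC F k K D = fun cj => ((coarseCoord F k K D cj : ℝ) : ℂ) :=
  funext fun cj => su2CoordCt_of_mem_lieSU (hD cj.1) cj.2

/-- The real coordinate vector `e_i` read in `ℂ` is the complex coordinate vector `e_i`. [folklore] -/
theorem ofReal_comp_single {ι : Type*} [DecidableEq ι] (i : ι) :
    (fun i' => (((Pi.single i (1 : ℝ) : ι → ℝ) i' : ℝ) : ℂ)) = (Pi.single i (1 : ℂ) : ι → ℂ) := by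
  funext i'
  by_cases h : i' = i
  · subst h; simp
  · simp [Pi.single_eq_of_ne h]

open Classical in
/-- ★ **BRIDGE**: the complex 𝔰𝔩(2)-coordinates of `LQ̃_ℂ e_i` are ed.15d's real matrix entries `recordLQtMat (c, j) i` ((o1-β)₃a `recordLQtC ↑x = recordLQt x` + `LQ̃` is 𝔰𝔲(2)-valued).
[cite: Balaban1987RG1, p.267 («L is a linear transformation»)] -/
theorem su2CoordCt_recordLQtC_single (k K : ℕ) (hk : k + 1 ≤ (F.P K).m + (F.P K).K) (Vk : GaugeField (F.P K) k (SU 2)) {ε : ℝ}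
    (hε : ∀ (c : PBond (F.P K) (k + 1)) (i : Idx (F.P K)), ‖loopM (coeField Vk) c i - 1‖ ≤ ε) (hε50 : ε ≤ 1 / 50)
    (hVk : ∀ c, Small expMeanLogSU Vk c) (cj : CoarseIdx F k K) (i : FluctIdx F k K) :
    su2CoordCt (recordLQtC F k K Vk (Pi.single i 1) cj.1) cj.2 = ((recordLQtMat F k K Vk cj i : ℝ) : ℂ) := by
  rw [← ofReal_comp_single, recordLQtC_ofReal F k K hk Vk hε hε50 hVk,
    su2CoordCt_of_mem_lieSU (recordLQt_mem_lieSU_of_small F k K Vk hVk _ _)]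
  rfl

open Classical in
/-- ★ **BRIDGE (◆ R-k)**: DEF-1's entrywise-complexified block `recordLQtB0C Vk` IS the `b₀`-block of `coarseCoordC ∘ recordLQtC Vk`. [cite: Balaban1987RG1, p.267–268] -/
theorem recordLQtB0C_eq (k K : ℕ) (hk : k + 1 ≤ (F.P K).m + (F.P K).K) (Vk : GaugeField (F.P K) k (SU 2)) {ε : ℝ}
    (hε : ∀ (c : PBond (F.P K) (k + 1)) (i : Idx (F.P K)), ‖loopM (coeField Vk) c i - 1‖ ≤ ε) (hε50 : ε ≤ 1 / 50)
    (hVk : ∀ c, Small expMeanLogSU Vk c) (cj c'j' : CoarseIdx F k K) :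
    recordLQtB0C F k K Vk cj c'j' = su2CoordCt (recordLQtC F k K Vk (Pi.single (recordB0 F k K c'j'.1, c'j'.2) 1) cj.1) cj.2 := by
  rw [recordLQtB0C_apply, su2CoordCt_recordLQtC_single F k K hk Vk hε hε50 hVk]
  rfl

open Classical in
/-- ★ **`coarseCoordC (LQ̃_ℂ v) = (recordLQtMat.map ↑) *ᵥ v`** for every COMPLEX fluctuation vector `v` (ℂ-linearity + the bridge on coordinate vectors). [cite: Balaban1987RG1, p.267] -/
theorem coarseCoordC_recordLQtC (k K : ℕ) (hk : k + 1 ≤ (F.P K).m + (F.P K).K) (Vk : GaugeField (F.P K) k (SU 2)) {ε : ℝ}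
    (hε : ∀ (c : PBond (F.P K) (k + 1)) (i : Idx (F.P K)), ‖loopM (coeField Vk) c i - 1‖ ≤ ε) (hε50 : ε ≤ 1 / 50)
    (hVk : ∀ c, Small expMeanLogSU Vk c) (v : FluctIdx F k K → ℂ) :
    coarseCoordC F k K (recordLQtC F k K Vk v) = (recordLQtMat F k K Vk).map (algebraMap ℝ ℂ) *ᵥ v := by
  have hv : v = ∑ i, v i • (Pi.single i (1 : ℂ) : FluctIdx F k K → ℂ) := by
    conv_lhs => rw [← Finset.univ_sum_single v]
    refine Finset.sum_congr rfl fun i _ => ?_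
    funext i'
    by_cases h : i' = i
    · subst h; simp
    · simp [Pi.single_eq_of_ne h]
  funext cj
  conv_lhs => rw [hv]
  rw [map_sum]
  show su2CoordCt ((∑ i, recordLQtC F k K Vk (v i • (Pi.single i (1 : ℂ) : FluctIdx F k K → ℂ))) cj.1) cj.2 = _
  simp only [map_smul, Finset.sum_apply, Pi.smul_apply]
  rw [su2CoordCt_sum_smul]
  simp only [su2CoordCt_recordLQtC_single F k K hk Vk hε hε50 hVk, Matrix.mulVec, dotProduct, Matrix.map_apply]
  exact Finset.sum_congr rfl fun i _ => by rw [mul_comm]; rfl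

open Classical in
/-- `LQ̃_ℂ v` is trace-free at every coarse bond, for every complex `v`. [cite: Balaban1987RG1, p.267] -/
theorem trace_recordLQtC_apply (k K : ℕ) (hk : k + 1 ≤ (F.P K).m + (F.P K).K) (Vk : GaugeField (F.P K) k (SU 2)) {ε : ℝ}
    (hε : ∀ (c : PBond (F.P K) (k + 1)) (i : Idx (F.P K)), ‖loopM (coeField Vk) c i - 1‖ ≤ ε) (hε50 : ε ≤ 1 / 50)
    (hVk : ∀ c, Small expMeanLogSU Vk c) (v : FluctIdx F k K → ℂ) (c : PBond (F.P K) (k + 1)) :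
    (recordLQtC F k K Vk v c).trace = 0 := by
  have hv : v = ∑ i, v i • (Pi.single i (1 : ℂ) : FluctIdx F k K → ℂ) := by
    conv_lhs => rw [← Finset.univ_sum_single v]
    refine Finset.sum_congr rfl fun i _ => ?_
    funext i'
    by_cases h : i' = i
    · subst h; simp
    · simp [Pi.single_eq_of_ne h]
  rw [hv, map_sum, Finset.sum_apply, Matrix.trace_sum]
  refine Finset.sum_eq_zero fun i _ => ?_
  rw [map_smul, Pi.smul_apply, Matrix.trace_smul, ← ofReal_comp_single, recordLQtC_ofReal F k K hk Vk hε hε50 hVk,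
    (mem_lieSU_iff.1 (recordLQt_mem_lieSU_of_small F k K Vk hVk _ c)).2, smul_zero]

/-! ## §2  `hopLinGraphC` on 𝔰𝔲(2)-fields is `↑hopLinGraph` -/

/-- Entrywise complexification commutes with the nonsingular inverse (junk included: both sides are `0` off `IsUnit det`). [folklore] -/
theorem map_algebraMap_nonsing_inv {n : Type*} [Fintype n] [DecidableEq n] (A : Matrix n n ℝ) :
    (A.map (algebraMap ℝ ℂ))⁻¹ = A⁻¹.map (algebraMap ℝ ℂ) := by
  by_cases h : IsUnit A.det
  · refine Matrix.inv_eq_left_inv ?_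
    rw [← Matrix.map_mul, Matrix.nonsing_inv_mul _ h, Matrix.map_one _ (map_zero _) (map_one _)]
  · have h' : ¬ IsUnit (A.map (algebraMap ℝ ℂ)).det := by
      rw [← RingHom.mapMatrix_apply, ← RingHom.map_det]
      intro hu
      apply h
      rw [isUnit_iff_ne_zero] at hu ⊢
      exact fun h0 => hu (by rw [h0, map_zero])
    rw [Matrix.nonsing_inv_apply_not_isUnit _ h, Matrix.nonsing_inv_apply_not_isUnit _ h', Matrix.map_zero _ (map_zero _)]

/-- The letter in `ℂ`: `RecordB0BlockInvertible` makes `recordLQtB0C` invertible. [cite: Balaban1987RG1, p.267–268] -/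
theorem isUnit_det_recordLQtB0C (k K : ℕ) (Vk : GaugeField (F.P K) k (SU 2)) (hA : RecordB0BlockInvertible F k K Vk) :
    IsUnit (recordLQtB0C F k K Vk).det := by
  unfold recordLQtB0C
  rw [← RingHom.mapMatrix_apply, ← RingHom.map_det]
  exact hA.map _

open Classical in
/-- `h_ℂ D` on a central-bond coordinate `(b₀(c), j)` is `(A₁^ℂ⁻¹ · coarseCoordC D)(c, j)` (standing range: `b₀` injective). [cite: Balaban1987RG1, p.267 («(hB)(b₀(c)) = h(c)B(c)»)] -/
theorem hopLinGraphC_apply_b0 (k K : ℕ) (hk : k + 1 ≤ (F.P K).m + (F.P K).K) (Vk : GaugeField (F.P K) k (SU 2)) (D : PBond (F.P K) (k + 1) → MatA 2)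
    (c : PBond (F.P K) (k + 1)) (j : Fin 3) :
    hopLinGraphC F k K Vk D (recordB0 F k K c, j) = ((recordLQtB0C F k K Vk)⁻¹ *ᵥ coarseCoordC F k K D) (c, j) := by
  have hmem : (recordB0 F k K c, j).1 ∈ Set.range (recordB0 F k K) := ⟨c, rfl⟩
  have hch : hmem.choose = c := BlockAveragingHaarAC.centralBond_injective hk hmem.choose_spec
  rw [hopLinGraphC_apply_of_mem F k K Vk D _ hmem, hch]

open Classical in
/-- ★ **BRIDGE (◆ R-k)**: on 𝔰𝔲(2)-valued coarse fields DEF-1's complexified `h_ℂ` IS ▶ PT-A-1's real `h` read in `ℂ`: `hopLinGraphC Vk D = ↑(hopLinGraph Vk D)`.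
[cite: Balaban1987RG1, p.267 («(hB)(b₀(c)) = h(c)B(c)»)] -/
theorem hopLinGraphC_of_mem_lieSU (k K : ℕ) (Vk : GaugeField (F.P K) k (SU 2)) (D : PBond (F.P K) (k + 1) → MatA 2) (hD : ∀ c, D c ∈ lieSU (Fin 2)) :
    hopLinGraphC F k K Vk D = fun i => ((hopLinGraph F k K Vk D i : ℝ) : ℂ) := by
  funext i
  by_cases h : i.1 ∈ Set.range (recordB0 F k K)
  · rw [hopLinGraphC_apply_of_mem F k K Vk D i h]
    have hr : hopLinGraph F k K Vk D i = ((recordLQtB0 F k K Vk)⁻¹ *ᵥ coarseCoord F k K D) (h.choose, i.2) := by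
      show (if h : i.1 ∈ Set.range (recordB0 F k K) then ((recordLQtB0 F k K Vk)⁻¹ *ᵥ coarseCoord F k K D) (h.choose, i.2) else 0) = _
      rw [dif_pos h]
    rw [hr, coarseCoordC_of_mem_lieSU F k K D hD]
    unfold recordLQtB0C
    rw [map_algebraMap_nonsing_inv]
    exact (RingHom.map_mulVec (algebraMap ℝ ℂ) _ _ _).symm
  · rw [hopLinGraphC_apply_of_not_mem F k K Vk D i h, hopLinGraph_apply_of_not_mem F k K Vk D i h, Complex.ofReal_zero]

/-! ## §3  «LQ̃h = I» over `ℂ` -/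

open Classical in
/-- ★★ **«LQ̃h = I» IN COMPLEX COORDINATES**: `coarseCoordC (LQ̃_ℂ (h_ℂ D)) = coarseCoordC D` for every coarse matrix field `D`, under the letter `RecordB0BlockInvertible` (block bookkeeping along
`blkToFluct`, `A₁^ℂ · A₁^ℂ⁻¹ = 1`). [cite: Balaban1987RG1, p.267 («LQ̃h = I»)] -/
theorem coarseCoordC_recordLQtC_hopLinGraphC (k K : ℕ) (hk : k + 1 ≤ (F.P K).m + (F.P K).K) (Vk : GaugeField (F.P K) k (SU 2)) {ε : ℝ}
    (hε : ∀ (c : PBond (F.P K) (k + 1)) (i : Idx (F.P K)), ‖loopM (coeField Vk) c i - 1‖ ≤ ε) (hε50 : ε ≤ 1 / 50)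
    (hVk : ∀ c, Small expMeanLogSU Vk c) (hA : RecordB0BlockInvertible F k K Vk) (D : PBond (F.P K) (k + 1) → MatA 2) :
    coarseCoordC F k K (recordLQtC F k K Vk (hopLinGraphC F k K Vk D)) = coarseCoordC F k K D := by
  rw [coarseCoordC_recordLQtC F k K hk Vk hε hε50 hVk]
  set e : CoarseIdx F k K ⊕ NonB0Idx F k K ≃ FluctIdx F k K := Equiv.ofBijective _ (blkToFluct_bijective F k K hk) with he
  have key : (recordLQtMat F k K Vk).map (algebraMap ℝ ℂ) *ᵥ hopLinGraphC F k K Vk D =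
      recordLQtB0C F k K Vk *ᵥ ((recordLQtB0C F k K Vk)⁻¹ *ᵥ coarseCoordC F k K D) := by
    funext r
    simp only [Matrix.mulVec, dotProduct]
    rw [← e.sum_comp, Fintype.sum_sum_type]
    have h2 : ∑ n : NonB0Idx F k K, (recordLQtMat F k K Vk).map (algebraMap ℝ ℂ) r (e (Sum.inr n)) * hopLinGraphC F k K Vk D (e (Sum.inr n)) = 0 := by
      refine Finset.sum_eq_zero fun n _ => ?_
      have hn : e (Sum.inr n) = n.1 := rfl
      rw [hn, hopLinGraphC_apply_of_not_mem F k K Vk D n.1 n.2, mul_zero]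
    rw [h2, add_zero]
    refine Finset.sum_congr rfl fun cj _ => ?_
    have hcj : e (Sum.inl cj) = (recordB0 F k K cj.1, cj.2) := rfl
    rw [hcj, hopLinGraphC_apply_b0 F k K hk Vk D cj.1 cj.2]
    rfl
  rw [key, Matrix.mulVec_mulVec, Matrix.mul_nonsing_inv _ (isUnit_det_recordLQtB0C F k K Vk hA), Matrix.one_mulVec]

open Classical in
/-- ★★ **«LQ̃h = I» ON TRACE-FREE FIELDS**: `LQ̃_ℂ (h_ℂ D) = D` for every 𝔰𝔩(2,ℂ)-valued coarse field `D` (both sides are trace-free and have the same projected coordinates). The fields `D̃(B)` of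
p.267 are such (`C̃ = Q̃ − LQ̃` is trace-free-valued), so this is the «LQ̃h = I» the linearisation uses. [cite: Balaban1987RG1, p.267 («LQ̃h = I»)] -/
theorem recordLQtC_hopLinGraphC_of_trace_eq_zero (k K : ℕ) (hk : k + 1 ≤ (F.P K).m + (F.P K).K) (Vk : GaugeField (F.P K) k (SU 2)) {ε : ℝ}
    (hε : ∀ (c : PBond (F.P K) (k + 1)) (i : Idx (F.P K)), ‖loopM (coeField Vk) c i - 1‖ ≤ ε) (hε50 : ε ≤ 1 / 50)
    (hVk : ∀ c, Small expMeanLogSU Vk c) (hA : RecordB0BlockInvertible F k K Vk) (D : PBond (F.P K) (k + 1) → MatA 2)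
    (hD : ∀ c, (D c).trace = 0) :
    recordLQtC F k K Vk (hopLinGraphC F k K Vk D) = D := by
  have hcoord := coarseCoordC_recordLQtC_hopLinGraphC F k K hk Vk hε hε50 hVk hA D
  funext c
  rw [← sum_su2CoordCt_smul_su2Gen (trace_recordLQtC_apply F k K hk Vk hε hε50 hVk _ c), ← sum_su2CoordCt_smul_su2Gen (hD c)]
  refine Finset.sum_congr rfl fun a _ => ?_
  have h := congrFun hcoord (c, a)
  simp only [coarseCoordC] at h
  rw [h]

end Summit.QuantumFields.YangMills.Theorems.BalabanUVNodesPortS1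

end
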